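import Literature.Geometry.Kaehler.HolomorphicLineBundleCechSmoothing
import Literature.Geometry.Kaehler.HolomorphicLineBundleCechH0
import HarnessLib

/-!
# Čech cohomology of `𝒪(L)` on a zero-dimensional complex manifold

Layer `Literature/Geometry/Kaehler`. The base level of Serre's dimension count (J.-P. Serre,
*Géométrie algébrique et géométrie analytique* (1956), n° 16 Lemme 8; *Faisceaux algébriques
cohérents* (1955), n° 81): on the finite set `Z = {t₁ = ⋯ = t_n = 0}` of common zeroes of a
transverse flag of sections the restricted sheaf is a non-zero skyscraper, so `h¹ = 0 < h⁰`.

In the tree's format the finite transversal intersection is a genuine complex manifold modelled on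
`Fin 0 → ℂ` (`AmbientHolAtlas.Carrier` of the deepest regular zero locus, file `RegularZeroLocus`),
and this file proves, for ANY space `N` charted over the one-point model `Fin 0 → ℂ`:

* `discreteTopology_of_chartedSpace_finZero` — `N` is discrete (a chart source is a singleton);
* `mdifferentiable_of_chartedSpace_finZero` — every map `N → F` into a normed space is holomorphic;
* `HolomorphicLineBundle.FramedCover.subsingleton_cohomology_one_of_finZero` /
  `finrank_cohomology_one_of_finZero` — for every cocycle line bundle `L` on `N` and every COVERING
  framed cover `𝔙`, `Ȟ¹(𝔙, 𝒪(L)) = 0`: a `1`-cocycle `z` is the coboundary of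
  `b_l(x) = g_{frame k(x), frame l}(x) z_{(k(x), l)}(x)` for any choice `x ∈ V_{k(x)}` (the contraction by
  the locally constant partition of unity `1_{k = k(x)}`, holomorphic because `N` is discrete);
* `HolomorphicLineBundle.h0_pos_of_finZero` / `FramedCover.finrank_cohomology_zero_pos_of_finZero` —
  if `N` is non-empty (and compact, for `h⁰` to be a dimension), `0 < h⁰(N, L)`: the section equal to
  the frame `σ_{i₀}` at one point `x₀` and `0` elsewhere is a non-zero global holomorphic section.

Everything is proved; no new definitions besides the names of these theorems.

## References

* J.-P. Serre, *Géométrie algébrique et géométrie analytique*, Ann. Inst. Fourier 6 (1956), n° 16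
  Lemme 8. [SerreGAGA1956]
* J.-P. Serre, *Faisceaux algébriques cohérents*, Ann. of Math. 61 (1955), n° 81. [SerreFAC1955]
-/

noncomputable section

open scoped Manifold Topology ContDiff
open Set Function

namespace Literature.Geometry.Kaehler

/-! ### Spaces charted over the one-point model are discrete -/

section Discrete

variable {N : Type*} [TopologicalSpace N] [ChartedSpace (Fin 0 → ℂ) N]

/-- The source of a chart into the one-point model `Fin 0 → ℂ` is the singleton of its base point.
[folklore] -/
theorem chartAt_source_eq_singleton_of_finZero (x : N) : (chartAt (Fin 0 → ℂ) x).source = {x} := by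
  refine Set.eq_singleton_iff_unique_mem.2 ⟨mem_chart_source _ x, fun y hy ↦ ?_⟩
  exact (chartAt (Fin 0 → ℂ) x).injOn hy (mem_chart_source _ x) (Subsingleton.elim _ _)

/-- **A space charted over `Fin 0 → ℂ` is discrete.** [folklore] -/
theorem discreteTopology_of_chartedSpace_finZero : DiscreteTopology N := by
  rw [discreteTopology_iff_isOpen_singleton]
  intro x
  rw [← chartAt_source_eq_singleton_of_finZero x]
  exact (chartAt (Fin 0 → ℂ) x).open_source

/-- **Every map out of a space charted over `Fin 0 → ℂ` is holomorphic.** [folklore] -/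
theorem mdifferentiable_of_chartedSpace_finZero {F : Type*} [NormedAddCommGroup F] [NormedSpace ℂ F]
    (f : N → F) : MDifferentiable 𝓘(ℂ, Fin 0 → ℂ) 𝓘(ℂ, F) f := fun x ↦ by
  haveI := discreteTopology_of_chartedSpace_finZero (N := N)
  have h : f =ᶠ[𝓝 x] fun _ ↦ f x := by
    rw [nhds_discrete]
    exact Filter.eventually_pure.2 rfl
  exact mdifferentiableAt_const.congr_of_eventuallyEq h

/-- Every map out of a space charted over `Fin 0 → ℂ` is holomorphic on every set. [folklore] -/
theorem mdifferentiableOn_of_chartedSpace_finZero {F : Type*} [NormedAddCommGroup F] [NormedSpace ℂ F]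
    (f : N → F) (s : Set N) : MDifferentiableOn 𝓘(ℂ, Fin 0 → ℂ) 𝓘(ℂ, F) f s :=
  (mdifferentiable_of_chartedSpace_finZero f).mdifferentiableOn

end Discrete

namespace HolomorphicLineBundle

variable {ι κ : Type*} {N : Type*} [TopologicalSpace N] [ChartedSpace (Fin 0 → ℂ) N]

namespace FramedCover

variable {L : HolomorphicLineBundle ι (Fin 0 → ℂ) N} (C : L.FramedCover κ)

/-! ### `Ȟ¹ = 0` on a zero-dimensional manifold -/

section H1

variable (k : N → κ)

open scoped Classical in
/-- The contraction of a `1`-cochain by a choice `x ∈ V_{k(x)}`: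
`b_J(x) = g_{frame k(x), frame (J 0)}(x) · z_{(k(x), J 0)}(x)` on `V_J`, `0` off `V_J`. [cite: SerreFAC1955, n° 81] -/
def contractFun (z : C.Cochain 1) (J : Fin 1 → κ) : N → ℂ := fun x ↦
  if x ∈ cechSet C.U J then
    L.coordChange (C.frame (k x)) (C.frame (J 0)) x * (z ![k x, J 0] : N → ℂ) x
  else 0

/-- The contraction is a `0`-cochain (holomorphy is automatic on a discrete space). [folklore] -/
theorem contractFun_mem (z : C.Cochain 1) (J : Fin 1 → κ) :
    C.contractFun k z J ∈ holFunOn (Fin 0 → ℂ) (cechSet C.U J) :=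
  ⟨mdifferentiableOn_of_chartedSpace_finZero _ _, fun _ hx ↦ if_neg hx⟩

/-- The contraction as a linear map `C¹ → C⁰`. [cite: SerreFAC1955, n° 81] -/
def contractZero : C.Cochain 1 →ₗ[ℂ] C.Cochain 0 where
  toFun z J := ⟨C.contractFun k z J, C.contractFun_mem k z J⟩
  map_add' z z' := by
    funext J
    refine Subtype.ext (funext fun x ↦ ?_)
    change C.contractFun k (z + z') J x = C.contractFun k z J x + C.contractFun k z' J x
    simp only [contractFun, Pi.add_apply, Submodule.coe_add]
    split_ifs <;> ring
  map_smul' c z := by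
    funext J
    refine Subtype.ext (funext fun x ↦ ?_)
    change C.contractFun k (c • z) J x = c * C.contractFun k z J x
    simp only [contractFun, Pi.smul_apply, Submodule.coe_smul, smul_eq_mul]
    split_ifs <;> ring

/-- The contraction at a point of `V_J`. [folklore] -/
theorem contractZero_apply_apply_of_mem (z : C.Cochain 1) {J : Fin 1 → κ} {x : N}
    (hx : x ∈ cechSet C.U J) :
    (C.contractZero k z J : N → ℂ) x =
      L.coordChange (C.frame (k x)) (C.frame (J 0)) x * (z ![k x, J 0] : N → ℂ) x :=
  if_pos hx

variable {k}

/-- **On a zero-dimensional manifold every `1`-cocycle of `𝒪(L)` is a coboundary**: if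
`x ∈ V_{k(x)}` for all `x`, then `δ (contractZero k z) = z` for every cocycle `z`.
[cite: SerreFAC1955, n° 81] -/
theorem delta_contractZero (hk : ∀ x, x ∈ C.U (k x)) {z : C.Cochain 1} (hz : C.delta 1 z = 0) :
    C.delta 0 (C.contractZero k z) = z := by
  funext J
  refine Subtype.ext (funext fun x ↦ ?_)
  have hJ : J = ![J 0, J 1] := by
    funext i; fin_cases i <;> rfl
  by_cases hx : x ∈ cechSet C.U J
  · have hx' : x ∈ C.U (J 0) ∩ C.U (J 1) :=
      ⟨cechSet_subset_apply C.U J 0 hx, cechSet_subset_apply C.U J 1 hx⟩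
    have h0 : x ∈ cechSet C.U ![J 0] := by
      rw [mem_cechSet_iff]; intro i; fin_cases i; exact hx'.1
    have h1 : x ∈ cechSet C.U ![J 1] := by
      rw [mem_cechSet_iff]; intro i; fin_cases i; exact hx'.2
    rw [hJ, C.delta_zero_apply_apply _ (J 0) (J 1) hx', C.contractZero_apply_apply_of_mem k z h1,
      C.contractZero_apply_apply_of_mem k z h0]
    simp only [Matrix.cons_val_zero]
    -- the cocycle condition at `(k x, J 0, J 1)` and the cocycle of transition functions
    have hc := C.delta_one_eq_zero_apply hz (k x) (J 0) (J 1) ⟨⟨hk x, hx'.1⟩, hx'.2⟩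
    have hkb : x ∈ L.baseSet (C.frame (k x)) := C.subset _ (hk x)
    have h0b : x ∈ L.baseSet (C.frame (J 0)) := C.subset _ hx'.1
    have h1b : x ∈ L.baseSet (C.frame (J 1)) := C.subset _ hx'.2
    have hcomp : L.coordChange (C.frame (J 1)) (C.frame (J 0)) x *
        L.coordChange (C.frame (k x)) (C.frame (J 1)) x =
        L.coordChange (C.frame (k x)) (C.frame (J 0)) x := by
      rw [mul_comm]
      exact L.coordChange_comp _ _ _ x ⟨⟨hkb, h1b⟩, h0b⟩
    have hinv : L.coordChange (C.frame (k x)) (C.frame (J 0)) x *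
        L.coordChange (C.frame (J 0)) (C.frame (k x)) x = 1 := by
      rw [L.coordChange_comp _ _ _ x ⟨⟨hkb, h0b⟩, hkb⟩]
      exact L.coordChange_self _ hkb
    linear_combination ((z ![k x, J 1] : N → ℂ) x) * hcomp
      - L.coordChange (C.frame (k x)) (C.frame (J 0)) x * hc
      + ((z ![J 0, J 1] : N → ℂ) x) * hinv
  · rw [holFunOn.apply_of_notMem _ hx, holFunOn.apply_of_notMem _ hx]

/-- **`Ȟ¹(𝔙, 𝒪(L)) = 0` for every covering framed cover of a cocycle line bundle on a
zero-dimensional complex manifold.** [cite: SerreFAC1955, n° 81] -/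
theorem subsingleton_cohomology_one_of_finZero (hcov : ∀ x : N, ∃ l, x ∈ C.U l) :
    Subsingleton (C.cohomology 1) := by
  choose k hk using hcov
  refine ⟨fun a b ↦ ?_⟩
  obtain ⟨za, rfl⟩ := Literature.Algebra.Homology.NatCochain.Cohomology.mk_surjective
    (R := ℂ) (fun a ↦ C.delta a) 1 a
  obtain ⟨zb, rfl⟩ := Literature.Algebra.Homology.NatCochain.Cohomology.mk_surjective
    (R := ℂ) (fun a ↦ C.delta a) 1 b
  refine (Literature.Algebra.Homology.NatCochain.Cohomology.mk_eq_mk_iff (R := ℂ)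
    (fun a ↦ C.delta a) za zb).2 ?_
  rw [Literature.Algebra.Homology.NatCochain.mem_coboundaries_succ_iff]
  refine ⟨C.contractZero k ((za : C.Cochain 1) - zb), ?_⟩
  have hza := (Literature.Algebra.Homology.NatCochain.mem_cocycles_iff (R := ℂ)
    (fun a ↦ C.delta a)).1 za.2
  have hzb := (Literature.Algebra.Homology.NatCochain.mem_cocycles_iff (R := ℂ)
    (fun a ↦ C.delta a)).1 zb.2
  exact C.delta_contractZero hk (z := (za : C.Cochain 1) - zb) (by rw [map_sub, hza, hzb, sub_zero])

/-- `dim Ȟ¹(𝔙, 𝒪(L)) = 0` on a zero-dimensional complex manifold. [cite: SerreFAC1955, n° 81] -/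
theorem finrank_cohomology_one_of_finZero (hcov : ∀ x : N, ∃ l, x ∈ C.U l) :
    Module.finrank ℂ (C.cohomology 1) = 0 := by
  haveI := C.subsingleton_cohomology_one_of_finZero hcov
  exact Module.finrank_zero_of_subsingleton

end H1

end FramedCover

/-! ### `0 < h⁰` on a non-empty zero-dimensional manifold -/

variable (L : HolomorphicLineBundle ι (Fin 0 → ℂ) N)

open scoped Classical in
/-- **The point section**: on a zero-dimensional manifold the family `s_i = g_{i₀ i} · 1_{x₀}` (the
frame `σ_{i₀}` at the point `x₀ ∈ U_{i₀}`, zero elsewhere) is a global holomorphic section of `L`.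
[cite: SerreFAC1955, n° 81] -/
def pointSection {x₀ : N} {i₀ : ι} (hx₀ : x₀ ∈ L.baseSet i₀) : L.GlobalSection where
  coord i x := if x = x₀ then L.coordChange i₀ i x else 0
  mdifferentiableOn_coord _ := mdifferentiableOn_of_chartedSpace_finZero _ _
  coord_eq_mul i j x hx := by
    by_cases h : x = x₀
    · subst h
      rw [if_pos rfl, if_pos rfl, mul_comm]
      exact (L.coordChange_comp i₀ i j _ ⟨⟨hx₀, hx.1⟩, hx.2⟩).symm
    · rw [if_neg h, if_neg h, mul_zero]

open scoped Classical in
/-- The point section is the frame at its point: `s_{i₀}(x₀) = 1`. [folklore] -/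
theorem pointSection_coord_self {x₀ : N} {i₀ : ι} (hx₀ : x₀ ∈ L.baseSet i₀) :
    (L.pointSection hx₀).coord i₀ x₀ = 1 := by
  change (if x₀ = x₀ then L.coordChange i₀ i₀ x₀ else 0) = 1
  rw [if_pos rfl, L.coordChange_self _ hx₀]

/-- The point section does not vanish identically. [folklore] -/
theorem zeroSet_pointSection_ne_univ {x₀ : N} {i₀ : ι} (hx₀ : x₀ ∈ L.baseSet i₀) :
    (L.pointSection hx₀).zeroSet ≠ univ :=
  (L.pointSection hx₀).zeroSet_ne_univ_iff.2
    ⟨i₀, x₀, hx₀, by rw [L.pointSection_coord_self hx₀]; exact one_ne_zero⟩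

/-- **`0 < h⁰(N, L)` for a cocycle line bundle on a non-empty compact zero-dimensional complex
manifold.** [cite: SerreFAC1955, n° 81] -/
theorem h0_pos_of_finZero [T2Space N] [CompactSpace N] [IsManifold 𝓘(ℂ, Fin 0 → ℂ) ω N]
    [Nonempty N] : 0 < L.h0 := by
  haveI := L.finiteDimensional_sectionSpace
  obtain ⟨x₀⟩ := ‹Nonempty N›
  obtain ⟨i₀, hi₀⟩ := L.exists_mem_baseSet x₀
  exact L.h0_pos_of_zeroSet_ne_univ (L.pointSection hi₀) (L.zeroSet_pointSection_ne_univ hi₀)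

/-- **`h¹ < h⁰` at the base of Serre's tower**: for every covering framed cover of a cocycle line
bundle on a non-empty compact zero-dimensional complex manifold,
`dim Ȟ¹(𝔙, 𝒪(L)) < dim Ȟ⁰(𝔙, 𝒪(L))`. [cite: SerreGAGA1956, n° 16 Lemme 8] -/
theorem FramedCover.finrank_cohomology_one_lt_zero_of_finZero [T2Space N] [CompactSpace N]
    [IsManifold 𝓘(ℂ, Fin 0 → ℂ) ω N] [Nonempty N] (C : L.FramedCover κ)
    (hcov : ∀ x : N, ∃ l, x ∈ C.U l) :
    Module.finrank ℂ (C.cohomology 1) < Module.finrank ℂ (C.cohomology 0) := by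
  rw [C.finrank_cohomology_one_of_finZero hcov, C.finrank_cohomology_zero hcov]
  exact L.h0_pos_of_finZero

end HolomorphicLineBundle

end Literature.Geometry.Kaehler

end
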